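import Summits.BirchSwinnertonDyer.BirchSwinnertonDyer.Theorems.GenusKolyvaginAtTwoPowDvdShaCardAtTwoRTTransverseIsotropicRegular
import Summits.BirchSwinnertonDyer.BirchSwinnertonDyer.Theorems.GenusKolyvaginAtTwoHalfTransverseLocalDefs
import HarnessLib

/-!
# Route `GenusKolyvaginAtTwo`, crux L_T `PowDvdShaCardAtTwoRT` (stmt-BirchSwinnertonDyer-23242) / L⁺_T `PowDvdShaCardAtTwoPosT`
# (stmt-23379), LINE 18/19, bottom rung at a REGULAR Kolyvagin prime: I7½ (the doubled local cup product of two half-transverse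
# classes vanishes) with `hFμ` discharged by regularity, and the index-`≤ 2` half-transverse condition there

Seat `bsd-line-gk2-p3` g21 (PROVER seat 3/3, cell `bsd-f1-sign2`), `--supports 23242 --as helper` (serves LINE 19's 23379 verbatim).
THEOREMS ONLY; no `sorry`.  BSD is NOT proved by any of this; neither crux is.

WHY.  This seat's I7½ (`…RTHalfTransverseIsotropic`, p702376) is stated, like I7 (`…RTTransverseIsotropic`), for a Frobenius `F` that is
a REGULAR involution on `T = E[q]` AND inverts `μ_q` (`hFμ`).  On `Δ < 0` both come from `FrobEqFrobInfty` (`…Packaged`, p702950); at the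
REGULAR primes of LINE 19 (`Δ > 0`, `RegularKolyvaginSupplyAtTwo`) the involution is regular by supply and `hFμ` FOLLOWS from regularity
(g19 `smul_eq_inv_of_regular`, p693866: `e(P, FP)` is a primitive `q`-th root of unity).  So, exactly as `…RTTransverseIsotropicRegular`
did for I7:
* **`nsmul_cupProduct_localization_eq_zero_of_halfTransverse_of_regular`** — `p^{M−1}·(loc_v x ∪ₑ loc_v y) = 0` for `x, y`
  half-transverse at a regular Frobenius `F` (no `hFμ`);
* **`cupProduct_localization_nsmul_eq_zero_of_halfTransverse_of_regular`** — `loc_v (p^{M−1}·x) ∪ₑ loc_v y = 0`, the own-prime term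
  of the index-`≥ 2` bottom-rung engine with `X = 2^{M−1}·Z`;
* **`index_halfTransverseLocal_le_two_of_eq`** — the deep-own-prime local condition `halfTransverseLocal W q ℚ_v g₀` (this seat's
  `…HalfTransverseLocalDefs`, p703557) has index `≤ 2` as soon as `res g₀ = F` is a regular involution with `q` even — the count
  hypothesis of `…RTOrderFourAuxiliaryGeneral …_of_index_le_two` (p701532), on EITHER sign of `Δ`.
HONEST FRAMING: one-line corollaries; closes nothing.  BSD is NOT proved by any of this.

References: [McCallumLMS1991] §5 Lemma 5.3 and proof of Prop. 5.2; [GrossLMS1991] §3 (3.3).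
-/

set_option autoImplicit false
set_option linter.dupNamespace false -- tree convention: `Summit.BirchSwinnertonDyer.BirchSwinnertonDyer.Theorems` (summit = sub-problem)

noncomputable section
open scoped Classical Pointwise

namespace Summit.BirchSwinnertonDyer.BirchSwinnertonDyer.Theorems.GenusExact.TransverseIsotropy

open WeierstrassCurve NumberField IsDedekindDomain Field
open Literature.NumberTheory.EllipticCurves Literature.NumberTheory.GaloisRepresentations
open Literature.NumberTheory.GaloisCohomology

section Rat

variable {v : HeightOneSpectrum (𝓞 ℚ)} (W : WeierstrassCurve ℚ) [W.IsElliptic]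

/-- **I7½ at a REGULAR Frobenius (`hFμ` discharged)**: setting of `nsmul_cupProduct_localization_eq_zero_of_halfTransverse` without the
hypothesis that `F` inverts `μ_q` but with `e` non-degenerate; `x, y` HALF-TRANSVERSE at `F` ⟹ `p^{M−1}·(loc_v x ∪ₑ loc_v y) = 0`.
Applies verbatim at the `RegularKolyvaginSupplyAtTwo` primes of LINE 19 (`Δ > 0`). [cite: McCallumLMS1991, §5 Lemma 5.3 and proof of Prop. 5.2] -/
theorem nsmul_cupProduct_localization_eq_zero_of_halfTransverse_of_regular {p M q : ℕ} [NeZero q] (hp : p.Prime)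
    (hq : q = p ^ M) (hM : 1 ≤ M) (hqv : (q : 𝓞 ℚ) ∉ v.asIdeal)
    {𝔐 : Ideal (HeightOneSpectrum.localAbsIntegers v)} (h𝔐 : 𝔐 ∈ v.localPrimesAbove)
    {F : absoluteGaloisGroup ℚ}
    (hFrob : IsArithFrobAt (𝓞 ℚ) F (v.primeBelow (closureEmb (K := ℚ) (v.adicCompletion ℚ)) 𝔐))
    (hF : ∀ Q : geomTorsion W (q : ℤ), F • F • Q = Q)
    {P : geomTorsion W (q : ℤ)} (hPq : (q : ℤ) • P = 0)
    (hgen : ∀ Q : geomTorsion W (q : ℤ), ∃ x y : ℤ, Q = x • P + y • F • P)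
    (hfree : ∀ x y : ℤ, x • P + y • F • P = 0 → (q : ℤ) ∣ x ∧ (q : ℤ) ∣ y)
    (hI : (v.primeBelow (closureEmb (K := ℚ) (v.adicCompletion ℚ)) 𝔐).inertia (absoluteGaloisGroup ℚ) ≤
      torsionFixing W (q : ℤ))
    (hopen : IsOpen (torsionFixing W (q : ℤ) : Set (absoluteGaloisGroup ℚ)))
    (e : geomTorsion W q → geomTorsion W q → AlgebraicClosure ℚ)
    (hμ : ∀ S T, e S T ^ q = 1) (hadd₁ : ∀ S₁ S₂ T, e (S₁ + S₂) T = e S₁ T * e S₂ T)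
    (hadd₂ : ∀ S T₁ T₂, e S (T₁ + T₂) = e S T₁ * e S T₂) (halt : ∀ T, e T T = 1)
    (hnondeg : ∀ T, (∀ S, e S T = 1) → T = 0)
    (hgal : ∀ (σ : absoluteGaloisGroup ℚ) (S T : geomTorsion W q), σ • e S T = e (σ • S) (σ • T))
    {x y : galH1Torsion W (q : ℤ)}
    (hx : ∃ P₁ Q₁ : geomTorsion W (q : ℤ), h1Eval W (q : ℤ) x F = (F • P₁ - P₁) + p • Q₁)
    (hy : ∃ P₂ Q₂ : geomTorsion W (q : ℤ), h1Eval W (q : ℤ) y F = (F • P₂ - P₂) + p • Q₂) :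
    haveI := absoluteGaloisGroup_compactSpace (v.adicCompletion ℚ)
    p ^ (M - 1) • ((weilContPairing W q e hμ hadd₁ hadd₂ hgal).restrict
      (absGaloisRestrict ℚ (v.adicCompletion ℚ))).cupProduct
        (galoisCohomology.localization (W.torsionGaloisModule ((q : ℕ) : ℤ)) (Sum.inr v) 1 x)
        (galoisCohomology.localization (W.torsionGaloisModule ((q : ℕ) : ℤ)) (Sum.inr v) 1 y) = 0 :=
  nsmul_cupProduct_localization_eq_zero_of_halfTransverse W hp hq hM hqv h𝔐 hFrob
    (fun _ hζ ↦ smul_eq_inv_of_regular W e hμ hadd₁ hadd₂ halt hnondeg hgal hF hgen hfree hζ)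
    hF hPq hgen hfree hI hopen e hμ hadd₁ hadd₂ halt hgal hx hy

/-- **The own-prime term `loc_v (p^{M−1}·x) ∪ₑ loc_v y = 0` at a REGULAR Frobenius** (same setting). [cite: McCallumLMS1991, §5 proof of Prop. 5.2] -/
theorem cupProduct_localization_nsmul_eq_zero_of_halfTransverse_of_regular {p M q : ℕ} [NeZero q] (hp : p.Prime)
    (hq : q = p ^ M) (hM : 1 ≤ M) (hqv : (q : 𝓞 ℚ) ∉ v.asIdeal)
    {𝔐 : Ideal (HeightOneSpectrum.localAbsIntegers v)} (h𝔐 : 𝔐 ∈ v.localPrimesAbove)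
    {F : absoluteGaloisGroup ℚ}
    (hFrob : IsArithFrobAt (𝓞 ℚ) F (v.primeBelow (closureEmb (K := ℚ) (v.adicCompletion ℚ)) 𝔐))
    (hF : ∀ Q : geomTorsion W (q : ℤ), F • F • Q = Q)
    {P : geomTorsion W (q : ℤ)} (hPq : (q : ℤ) • P = 0)
    (hgen : ∀ Q : geomTorsion W (q : ℤ), ∃ x y : ℤ, Q = x • P + y • F • P)
    (hfree : ∀ x y : ℤ, x • P + y • F • P = 0 → (q : ℤ) ∣ x ∧ (q : ℤ) ∣ y)
    (hI : (v.primeBelow (closureEmb (K := ℚ) (v.adicCompletion ℚ)) 𝔐).inertia (absoluteGaloisGroup ℚ) ≤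
      torsionFixing W (q : ℤ))
    (hopen : IsOpen (torsionFixing W (q : ℤ) : Set (absoluteGaloisGroup ℚ)))
    (e : geomTorsion W q → geomTorsion W q → AlgebraicClosure ℚ)
    (hμ : ∀ S T, e S T ^ q = 1) (hadd₁ : ∀ S₁ S₂ T, e (S₁ + S₂) T = e S₁ T * e S₂ T)
    (hadd₂ : ∀ S T₁ T₂, e S (T₁ + T₂) = e S T₁ * e S T₂) (halt : ∀ T, e T T = 1)
    (hnondeg : ∀ T, (∀ S, e S T = 1) → T = 0)
    (hgal : ∀ (σ : absoluteGaloisGroup ℚ) (S T : geomTorsion W q), σ • e S T = e (σ • S) (σ • T))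
    {x y : galH1Torsion W (q : ℤ)}
    (hx : ∃ P₁ Q₁ : geomTorsion W (q : ℤ), h1Eval W (q : ℤ) x F = (F • P₁ - P₁) + p • Q₁)
    (hy : ∃ P₂ Q₂ : geomTorsion W (q : ℤ), h1Eval W (q : ℤ) y F = (F • P₂ - P₂) + p • Q₂) :
    haveI := absoluteGaloisGroup_compactSpace (v.adicCompletion ℚ)
    ((weilContPairing W q e hμ hadd₁ hadd₂ hgal).restrict
      (absGaloisRestrict ℚ (v.adicCompletion ℚ))).cupProduct
        (galoisCohomology.localization (W.torsionGaloisModule ((q : ℕ) : ℤ)) (Sum.inr v) 1 ((p ^ (M - 1) : ℕ) • x))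
        (galoisCohomology.localization (W.torsionGaloisModule ((q : ℕ) : ℤ)) (Sum.inr v) 1 y) = 0 :=
  cupProduct_localization_nsmul_eq_zero_of_halfTransverse W hp hq hM hqv h𝔐 hFrob
    (fun _ hζ ↦ smul_eq_inv_of_regular W e hμ hadd₁ hadd₂ halt hnondeg hgal hF hgen hfree hζ)
    hF hPq hgen hfree hI hopen e hμ hadd₁ hadd₂ halt hgal hx hy

end Rat

/-! ## The half-transverse local condition at a regular Frobenius lift, either sign of `Δ` -/

section Index

variable {K : Type} [Field K] [NumberField K] {v : HeightOneSpectrum (𝓞 K)} (W : WeierstrassCurve K) (n : ℤ)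

/-- **`index (halfTransverseLocal W n K_v g₀) ≤ 2` when `res g₀ = F` is a regular involution on `E[n]`** (`E[n]` free of rank one over
`ℤ/q[F]` on `P`, `q` even) — the hypotheses in the `F`-form used by I7 / I7½ / `RegularKolyvaginSupplyAtTwo`, `g₀` a local lift of `F`
(`exists_absGaloisRestrict_eq_of_isArithFrobAt`).  LINE 19 form of the count hypothesis of `…_of_index_le_two`. [folklore] -/
theorem index_halfTransverseLocal_le_two_of_eq (g₀ : absoluteGaloisGroup (v.adicCompletion K)) {F : absoluteGaloisGroup K}
    (hg₀ : absGaloisRestrict K (v.adicCompletion K) g₀ = F) {q : ℤ} (hq : (2 : ℤ) ∣ q)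
    (hF : ∀ Q : geomTorsion W n, F • F • Q = Q) {P : geomTorsion W n}
    (hgen : ∀ Q : geomTorsion W n, ∃ x y : ℤ, Q = x • P + y • F • P)
    (hfree : ∀ x y : ℤ, x • P + y • F • P = 0 → q ∣ x ∧ q ∣ y) :
    (halfTransverseLocal W n (v.adicCompletion K) g₀).index ≤ 2 := by
  subst hg₀
  exact index_halfTransverseLocal_le_two W n (v.adicCompletion K) g₀ hq hF hgen hfree

end Index

end Summit.BirchSwinnertonDyer.BirchSwinnertonDyer.Theorems.GenusExact.TransverseIsotropy

end
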